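import Literature.NumberTheory.EllipticCurves.BSDQuadraticDescentShaOddPartGeneralProofs
import Literature.NumberTheory.EllipticCurves.QuadraticTwistRank
import Literature.NumberTheory.EllipticCurves.MordellWeilTheoremProofs
import Literature.Algebra.Module.AlternatingPairingParity
import HarnessLib

/-!
# `#Sel_{p^∞}(E/F)[p] = p^{rank E(F)} · #Ш(E/F)[p]` in every rank, and the FINITENESS-FREE splitting
# `#Ш(E_K)[p] = #Ш(E)[p] · #Ш(E^{(c)})[p]` over a quadratic field `K = ℚ(√c)` for odd `p`

Topic `NumberTheory/EllipticCurves`; theorems only (no definition, no named fact, no `sorry`, no instance).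
Companion of `BSDQuadraticDescentShaOddPartProofs` / `…GeneralProofs`, which prove the ORDER identity
`#Ш(E_K)[p^∞] = #Ш(E)[p^∞] · #Ш(E^{(d_K)})[p^∞]` (odd `p`) in rank zero, resp. when the two `ℚ`-side groups
are finite. Here the `p`-TORSION layer is treated, where no finiteness of `Ш` is needed:

* §1 `WeierstrassCurve.natCard_torsionBy_selmerGroupPInfty_eq` — for an elliptic curve `E` over a number
  field `F` and ANY prime `p`: `#Sel_{p^∞}(E/F)[p] = p^{rank E(F)} · #Ш(E/F)[p]`, unconditionally (both sides are
  finite numbers: `Ш[p]` is finite, Silverman X.4.2(b)). Mechanism: the fundamental sequence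
  `0 → E(F) ⊗ ℚ_p/ℤ_p → Sel_{p^∞}(E/F) → Ш(E/F)[p^∞] → 0` (Greenberg 1999 §2; tree: `kummerMapPInfty`,
  `range_kummerMapPInfty`, `map_primaryH1ToH1_selmerGroupPInfty`) stays exact on `p`-torsion because
  `E(F) ⊗ ℚ_p/ℤ_p` is `p`-divisible (`natCard_torsionBy_eq_mul`), `#(E(F) ⊗ ℚ_p/ℤ_p)[p] = p^{rank}`
  (`natCard_torsionBy_tensorPrufer`, Mordell–Weil) and `Ш[p^∞][p] = Ш[p]`.
* §2 (odd `p`, `K = ℚ(θ)`, `θ² = c`): `#Sel_{p^∞}(E_K)[n] = #Sel_{p^∞}(E)[n] · #Sel_{p^∞}(E^{(c)})[n]` for every `n`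
  (`natCard_torsionBy_selmerGroupPInfty_baseChange_eq_mul`; the comparison ISOMORPHISM
  `Sel_{p^∞}(E) × Sel_{p^∞}(E^{(c)}) ≅ Sel_{p^∞}(E_K)` of the tree, `comparisonMap_bijective_of_odd`,
  Dokchitser–Dokchitser 2010 Lemma 4.14), and `rank E(K) = rank E(ℚ) + rank E^{(c)}(ℚ)`
  (`mordellWeilRank_baseChange_eq_add`, Silverman X Exercise 10.16, tree `lift_rank_point_baseChange_quadratic`).
* §3 **`#Ш(E_K/K)[p] = #Ш(E/ℚ)[p] · #Ш(E^{(c)}/ℚ)[p]` for every odd prime `p`, with NO finiteness hypothesis**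
  (`natCard_sha_torsionBy_baseChange_quadratic_of_odd`): divide §2 at `n = p` by `p^{rank E(K)}` using §1 three
  times. Model-free forms for `ℚ`-models of `E^{(d_K)}` and `K`-models of `E_K`
  (`natCard_sha_torsionBy_baseChange_quadratic_of_odd_of_variableChange`), and the descent readings: a first
  `p`-descent over `K` closes (`Ш(E_K)[p] = 0`) iff both `ℚ`-descents close; `dim_{𝔽_p} Ш(E_K)[p] =
  dim Ш(E)[p] + dim Ш(E^{(c)})[p]`.

At `p = 2` all of this fails (the comparison map has `2`-power kernel and cokernel); nothing is claimed there.

## References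

* R. Greenberg, *Iwasawa theory for elliptic curves*, LNM 1716 (1999), §1 pp. 54–57, §2 pp. 62–63. [Greenberg1999LNM]
* T. Dokchitser, V. Dokchitser, On the Birch–Swinnerton-Dyer quotients modulo squares, Ann. of Math. 172 (2010),
  Lemma 4.14 (proof). [DokchitserDokchitserAnnals2010]
* D. Jetchev, C. Skinner, X. Wan, The BSD formula for elliptic curves of analytic rank one, Camb. J. Math. 5
  (2017), §7.4.1. [JetchevSkinnerWan2017]
* J. H. Silverman, *The Arithmetic of Elliptic Curves*, 2nd ed. (2009), X.4.2, Exercise 10.16. [SilvermanAEC2009]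
-/

noncomputable section

open scoped Classical TensorProduct AddSubgroup

universe u

/-! ## §0 Counting torsion in a product -/

namespace Literature.NumberTheory.EllipticCurves

/-- `#(A × B)[n] = #A[n] · #B[n]` for abelian groups `A`, `B` and `n : ℕ` (the `n`-torsion of a product is the
product of the `n`-torsions). [folklore] -/
private theorem natCard_torsionBy_prod (A B : Type*) [AddCommGroup A] [AddCommGroup B] (n : ℕ) :
    Nat.card ((A × B)[(n : ℤ)]) = Nat.card (A[(n : ℤ)]) * Nat.card (B[(n : ℤ)]) := by
  rw [← Nat.card_prod]
  refine Nat.card_congr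
    { toFun := fun x ↦ (⟨x.1.1, ?_⟩, ⟨x.1.2, ?_⟩)
      invFun := fun y ↦ ⟨(y.1.1, y.2.1), ?_⟩
      left_inv := fun x ↦ by rfl
      right_inv := fun y ↦ by rfl }
  · have h := AddSubgroup.torsionBy.nsmul_iff.mp x.2
    exact AddSubgroup.torsionBy.nsmul_iff.mpr (congrArg Prod.fst h)
  · have h := AddSubgroup.torsionBy.nsmul_iff.mp x.2
    exact AddSubgroup.torsionBy.nsmul_iff.mpr (congrArg Prod.snd h)
  · exact AddSubgroup.torsionBy.nsmul_iff.mpr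
      (Prod.ext (AddSubgroup.torsionBy.nsmul_iff.mp y.1.2) (AddSubgroup.torsionBy.nsmul_iff.mp y.2.2))

/-- `#A[n] = #C[n]` along an additive isomorphism `A ≃+ C`. [folklore] -/
private theorem natCard_torsionBy_addEquiv {A C : Type*} [AddCommGroup A] [AddCommGroup C] (e : A ≃+ C) (n : ℕ) :
    Nat.card (A[(n : ℤ)]) = Nat.card (C[(n : ℤ)]) :=
  Nat.card_congr (torsionByEquiv e n).toEquiv

end Literature.NumberTheory.EllipticCurves

namespace WeierstrassCurve

open Literature.NumberTheory.EllipticCurves Literature.NumberTheory.QuadraticFields Literature.Algebra.Module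

/-! ## §1 `#Sel_{p^∞}(E/F)[p] = p^{rank E(F)} · #Ш(E/F)[p]` in every rank -/

section TorsionLayer

variable {F : Type u} [Field F] [NumberField F] (X : WeierstrassCurve F) [X.IsElliptic] (p : ℕ) [hp : Fact p.Prime]

/-- **`#Sel_{p^∞}(E/F)[p] = p^{rank E(F)} · #Ш(E/F)[p]`** for an elliptic curve `E` over a number field `F` and any
prime `p`, in every rank and with no finiteness hypothesis on `Ш`: the fundamental sequence
`0 → E(F) ⊗ ℚ_p/ℤ_p → Sel_{p^∞}(E/F) → Ш(E/F)[p^∞] → 0` (Greenberg 1999, §2, pp. 62–63) has `p`-divisible kernel,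
so it stays exact on `p`-torsion, `0 → (E(F) ⊗ ℚ_p/ℤ_p)[p] → Sel_{p^∞}(E/F)[p] → Ш(E/F)[p] → 0`, and
`#(E(F) ⊗ ℚ_p/ℤ_p)[p] = p^{rank E(F)}` (Mordell–Weil). Deliberate dot-notation extension of Mathlib's
`WeierstrassCurve` namespace. [cite: Greenberg1999LNM, §2 pp. 62–63] [cite: SilvermanAEC2009, Thm. X.4.2(b)] -/
theorem natCard_torsionBy_selmerGroupPInfty_eq :
    Nat.card ((selmerGroupPInfty X p)[(p : ℤ)]) = p ^ X.mordellWeilRank * Nat.card (X.sha[(p : ℤ)]) := by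
  haveI : Module.Finite ℤ X.toAffine.Point := X.module_finite_point_holds
  have hdiv : X.zsmul_geomPoints_surjective := X.zsmul_geomPoints_surjective_holds
  -- the players of the fundamental sequence
  set κ := kummerMapPInfty X p hdiv with hκ_def
  have hκinj : Function.Injective κ := kummerMapPInfty_injective X p hdiv
  have hκrange : κ.range = (primaryH1ToH1 X p).ker := range_kummerMapPInfty X p hdiv
  have hmap : (selmerGroupPInfty X p).map (primaryH1ToH1 X p) =
      (AddCommGroup.primaryComponent X.sha p).map X.sha.subtype :=
    X.map_primaryH1ToH1_selmerGroupPInfty p hdiv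
  set Sel := selmerGroupPInfty X p with hSel
  let f : Sel →+ X.galH1 := (primaryH1ToH1 X p).comp Sel.subtype
  have hkerle : (primaryH1ToH1 X p).ker ≤ Sel := ker_primaryH1ToH1_le_selmerGroupPInfty X p
  have hκmem : ∀ x, κ x ∈ Sel := fun x ↦ hkerle (hκrange ▸ ⟨x, rfl⟩)
  let i : X.toAffine.Point ⊗[ℤ] PruferQuot p →+ Sel := κ.codRestrict Sel hκmem
  -- the image of `Sel` is `Ш[p^∞]`
  have hrange : f.range = (AddCommGroup.primaryComponent X.sha p).map X.sha.subtype := by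
    rw [← hmap, AddMonoidHom.range_comp, AddSubgroup.range_subtype]
  let e : f.range ≃+ AddCommGroup.primaryComponent X.sha p :=
    (AddEquiv.addSubgroupCongr hrange).trans
      (AddSubgroup.equivMapOfInjective (AddCommGroup.primaryComponent X.sha p) X.sha.subtype
        Subtype.val_injective).symm
  -- counting `p`-torsion along `0 → E(F) ⊗ ℚ_p/ℤ_p → Sel → f.range → 0`
  have hcount := natCard_torsionBy_eq_mul (p := p) (i := i) (f := f.rangeRestrict) ?_
    f.rangeRestrict_surjective ?_ ?_ (tensorPrufer_divisible p _)
  · rw [hcount, natCard_torsionBy_tensorPrufer p X.toAffine.Point, natCard_torsionBy_addEquiv e p,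
      natCard_torsionBy_primaryComponent, mul_comm]
    rfl
  · -- injectivity of `i`
    intro x y hxy
    exact hκinj (congrArg (fun z : Sel ↦ (z : galH1Primary X p)) hxy)
  · -- exactness at `Sel`
    intro a ha
    have ha' : primaryH1ToH1 X p (a : galH1Primary X p) = 0 :=
      congrArg (fun z : f.range ↦ (z : X.galH1)) ha
    have hmem : (a : galH1Primary X p) ∈ κ.range := hκrange ▸ ha'
    obtain ⟨x, hx⟩ := hmem
    exact ⟨x, Subtype.ext hx⟩
  · -- `f ∘ i = 0`
    intro d
    apply Subtype.ext
    change primaryH1ToH1 X p (κ d) = 0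
    have : κ d ∈ (primaryH1ToH1 X p).ker := hκrange ▸ ⟨d, rfl⟩
    exact this

/-- **Rank-free reading: `#Ш(E/F)[p]` divides `#Sel_{p^∞}(E/F)[p]`**, the quotient being `p^{rank E(F)}`.
[cite: Greenberg1999LNM, §2 pp. 62–63] -/
theorem natCard_sha_torsionBy_dvd_selmerGroupPInfty :
    Nat.card (X.sha[(p : ℤ)]) ∣ Nat.card ((selmerGroupPInfty X p)[(p : ℤ)]) :=
  ⟨p ^ X.mordellWeilRank, by rw [natCard_torsionBy_selmerGroupPInfty_eq, mul_comm]⟩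

/-- **`Sel_{p^∞}(E/F)[p] = 0` iff `rank E(F) = 0` and `Ш(E/F)[p] = 0`** (in cardinalities:
`#Sel_{p^∞}[p] = 1 ↔ rank = 0 ∧ #Ш[p] = 1`). [cite: Greenberg1999LNM, §2 pp. 62–63] -/
theorem natCard_torsionBy_selmerGroupPInfty_eq_one_iff :
    Nat.card ((selmerGroupPInfty X p)[(p : ℤ)]) = 1 ↔ X.mordellWeilRank = 0 ∧ Nat.card (X.sha[(p : ℤ)]) = 1 := by
  rw [natCard_torsionBy_selmerGroupPInfty_eq, mul_eq_one, Nat.pow_eq_one, or_iff_right hp.out.ne_one]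

end TorsionLayer

/-! ## §2 Over a quadratic field, odd `p`: Selmer torsion and ranks split -/

section Quadratic

variable (W : WeierstrassCurve ℚ) [W.IsElliptic] (K : Type) [Field K] [NumberField K]
  (h2 : Module.finrank ℚ K = 2) {θ : K} {c : ℚ} (hθ : θ ∉ Set.range (algebraMap ℚ K))
  (hc : θ ^ 2 = algebraMap ℚ K c)

include hθ hc in
/-- `c ≠ 0` for a square-root generator `θ` of a quadratic field, `θ² = c`, `θ ∉ ℚ`. [folklore] -/
private theorem ne_zero_of_sq_eq_of_not_mem_range : c ≠ 0 := by
  rintro rfl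
  apply Quadratic.ne_zero_of_not_mem_range hθ
  have : θ ^ 2 = 0 := by rw [hc, map_zero]
  exact pow_eq_zero_iff (n := 2) (by norm_num) |>.mp this

include h2 hθ hc in
/-- **`rank E(K) = rank E(ℚ) + rank E^{(c)}(ℚ)` for `K = ℚ(θ)`, `θ² = c`** (Silverman X Exercise 10.16), in the
`c`-currency of the comparison map: the tree's cardinal identity `lift_rank_point_baseChange_quadratic` made an
identity of `finrank`s by the Mordell–Weil theorem over `K` (`module_finite_point_holds`). Deliberate dot-notation
extension of Mathlib's `WeierstrassCurve` namespace. [cite: SilvermanAEC2009, Exercise 10.16] -/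
theorem mordellWeilRank_baseChange_eq_add :
    (W.baseChange K).mordellWeilRank = W.mordellWeilRank + (W.quadraticTwist c).mordellWeilRank := by
  haveI : (W.baseChange K).IsElliptic := by rw [baseChange]; infer_instance
  haveI : Module.Finite ℤ (W.baseChange K).toAffine.Point := (W.baseChange K).module_finite_point_holds
  have hfin : Module.rank ℤ (W.baseChange K).toAffine.Point < Cardinal.aleph0 := Module.rank_lt_aleph0 ℤ _
  have h := lift_rank_point_baseChange_quadratic W h2 hθ hc
  simp only [Cardinal.lift_id] at h
  rw [h, Cardinal.add_lt_aleph0_iff] at hfin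
  unfold mordellWeilRank Module.finrank
  rw [h, Cardinal.toNat_add hfin.1 hfin.2]

include h2 hθ hc in
omit [W.IsElliptic] in
/-- **`#Sel_{p^∞}(E_K)[n] = #Sel_{p^∞}(E)[n] · #Sel_{p^∞}(E^{(c)})[n]` for odd `p` and every `n`**: the comparison map
`Sel_{p^∞}(E) × Sel_{p^∞}(E^{(c)}) → Sel_{p^∞}(E_K)` is an isomorphism for odd `p` (`comparisonMap_bijective_of_odd`,
Dokchitser–Dokchitser 2010, proof of Lemma 4.14), and the `n`-torsion of a product is the product of the `n`-torsions.
[cite: DokchitserDokchitserAnnals2010, Lemma 4.14 (proof)] -/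
theorem natCard_torsionBy_selmerGroupPInfty_baseChange_eq_mul (p : ℕ) [hp : Fact p.Prime] (hp2 : p ≠ 2) (n : ℕ) :
    Nat.card ((selmerGroupPInfty (W.baseChange K) p)[(n : ℤ)]) =
      Nat.card ((selmerGroupPInfty W p)[(n : ℤ)]) * Nat.card ((selmerGroupPInfty (W.quadraticTwist c) p)[(n : ℤ)]) := by
  have hodd : Odd p := hp.out.odd_of_ne_two hp2
  have e := AddEquiv.ofBijective _ (comparisonMap_bijective_of_odd W K h2 hθ hc p hodd)
  rw [← natCard_torsionBy_addEquiv e n, natCard_torsionBy_prod]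

/-! ## §3 `#Ш(E_K)[p] = #Ш(E)[p] · #Ш(E^{(c)})[p]` for odd `p`, finiteness-free -/

include h2 hθ hc in
/-- **`#Ш(E_K/K)[p] = #Ш(E/ℚ)[p] · #Ш(E^{(c)}/ℚ)[p]` for every ODD prime `p`, with NO finiteness hypothesis on `Ш`**
(`K = ℚ(θ)`, `θ² = c`): by §1 (three times) the identity of §2 at `n = p` reads
`p^{rank E(K)} · #Ш(E_K)[p] = p^{rank E(ℚ)} #Ш(E)[p] · p^{rank E^{(c)}(ℚ)} #Ш(E^{(c)})[p]`, and
`rank E(K) = rank E(ℚ) + rank E^{(c)}(ℚ)`. The `p^∞` version needs finiteness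
(`card_primaryComponent_sha_baseChange_quadratic_of_odd_of_finite`); the `p`-torsion layer does not.
Deliberate dot-notation extension of Mathlib's `WeierstrassCurve` namespace.
[cite: DokchitserDokchitserAnnals2010, Lemma 4.14 (proof)] [cite: JetchevSkinnerWan2017, §7.4.1 (arXiv:1512.06894 p. 30)]
[cite: Greenberg1999LNM, §2 pp. 62–63] -/
theorem natCard_sha_torsionBy_baseChange_quadratic_of_odd (p : ℕ) [hp : Fact p.Prime] (hp2 : p ≠ 2) :
    Nat.card ((W.baseChange K).sha[(p : ℤ)]) =
      Nat.card (W.sha[(p : ℤ)]) * Nat.card ((W.quadraticTwist c).sha[(p : ℤ)]) := by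
  haveI : (W.baseChange K).IsElliptic := by rw [baseChange]; infer_instance
  haveI : (W.quadraticTwist c).IsElliptic :=
    W.isElliptic_quadraticTwist (ne_zero_of_sq_eq_of_not_mem_range K hθ hc)
  have hS := natCard_torsionBy_selmerGroupPInfty_baseChange_eq_mul W K h2 hθ hc p hp2 p
  rw [natCard_torsionBy_selmerGroupPInfty_eq, natCard_torsionBy_selmerGroupPInfty_eq,
    natCard_torsionBy_selmerGroupPInfty_eq, mordellWeilRank_baseChange_eq_add W K h2 hθ hc, pow_add] at hS
  have hpow : 0 < p ^ W.mordellWeilRank * p ^ (W.quadraticTwist c).mordellWeilRank :=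
    Nat.mul_pos (pow_pos hp.out.pos _) (pow_pos hp.out.pos _)
  apply Nat.eq_of_mul_eq_mul_left hpow
  rw [hS]
  ring

include h2 hθ hc in
/-- **A first `p`-descent over `K` closes iff both `ℚ`-descents close** (`p` odd): `Ш(E_K)[p] = 0 ⟺ Ш(E)[p] = 0 ∧
Ш(E^{(c)})[p] = 0`, in cardinalities. [cite: DokchitserDokchitserAnnals2010, Lemma 4.14 (proof)] -/
theorem natCard_sha_torsionBy_baseChange_eq_one_iff_of_odd (p : ℕ) [hp : Fact p.Prime] (hp2 : p ≠ 2) :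
    Nat.card ((W.baseChange K).sha[(p : ℤ)]) = 1 ↔
      Nat.card (W.sha[(p : ℤ)]) = 1 ∧ Nat.card ((W.quadraticTwist c).sha[(p : ℤ)]) = 1 := by
  rw [natCard_sha_torsionBy_baseChange_quadratic_of_odd W K h2 hθ hc p hp2, mul_eq_one]

include h2 hθ hc in
/-- **Dimensions add**: if `#Ш(E)[p] = p^a` and `#Ш(E^{(c)})[p] = p^b` then `#Ш(E_K)[p] = p^{a+b}` (`p` odd), i.e.
`dim_{𝔽_p} Ш(E_K)[p] = dim Ш(E)[p] + dim Ш(E^{(c)})[p]`. [cite: DokchitserDokchitserAnnals2010, Lemma 4.14 (proof)] -/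
theorem natCard_sha_torsionBy_baseChange_eq_pow_add_of_odd (p : ℕ) [hp : Fact p.Prime] (hp2 : p ≠ 2) {a b : ℕ}
    (ha : Nat.card (W.sha[(p : ℤ)]) = p ^ a) (hb : Nat.card ((W.quadraticTwist c).sha[(p : ℤ)]) = p ^ b) :
    Nat.card ((W.baseChange K).sha[(p : ℤ)]) = p ^ (a + b) := by
  rw [natCard_sha_torsionBy_baseChange_quadratic_of_odd W K h2 hθ hc p hp2, ha, hb, pow_add]

include h2 hθ hc in
/-- **Each `ℚ`-side defect divides the defect over `K`** (`p` odd): `#Ш(E)[p] ∣ #Ш(E_K)[p]` and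
`#Ш(E^{(c)})[p] ∣ #Ш(E_K)[p]`. [cite: DokchitserDokchitserAnnals2010, Lemma 4.14 (proof)] -/
theorem natCard_sha_torsionBy_dvd_baseChange_of_odd (p : ℕ) [hp : Fact p.Prime] (hp2 : p ≠ 2) :
    Nat.card (W.sha[(p : ℤ)]) ∣ Nat.card ((W.baseChange K).sha[(p : ℤ)]) ∧
      Nat.card ((W.quadraticTwist c).sha[(p : ℤ)]) ∣ Nat.card ((W.baseChange K).sha[(p : ℤ)]) := by
  rw [natCard_sha_torsionBy_baseChange_quadratic_of_odd W K h2 hθ hc p hp2]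
  exact ⟨dvd_mul_right _ _, dvd_mul_left _ _⟩

end Quadratic

/-! ## §3' Model-free form: `ℚ`-models of `E^{(d_K)}` and `K`-models of `E_K` -/

section Models

/-- **`#Ш(C • E/L)[n] = #Ш(E/L)[n]`**: `Ш` is attached to the curve, not to the equation (the tree's `shaEquiv` is the
restriction of the additive `galH1Equiv`). [cite: SilvermanAEC2009, X.§4] -/
theorem natCard_sha_torsionBy_variableChange {L : Type u} [Field L] [NumberField L] (Y : WeierstrassCurve L)
    (C : VariableChange L) (n : ℕ) :
    Nat.card ((C • Y).sha[(n : ℤ)]) = Nat.card (Y.sha[(n : ℤ)]) :=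
  (natCard_torsionBy_addEquiv
    ({ shaEquiv Y C with
       map_add' := fun a b ↦
         Subtype.ext (map_add (galH1Equiv Y C) (a : Y.galH1) (b : Y.galH1)) } : Y.sha ≃+ (C • Y).sha) n).symm

/-- **`#Ш(W'/K)[p] = #Ш(E/ℚ)[p] · #Ш(Wd/ℚ)[p]` for odd `p`**, for every quadratic field `K`, every `ℚ`-model `Wd` of the
twist `E^{(d_K)}` and every `K`-model `W'` of `E_K` — the finiteness-free `p`-torsion companion of
`card_primaryComponent_sha_baseChange_quadratic_of_odd_of_finite` (same hypotheses minus the two `Finite`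
instances). [cite: DokchitserDokchitserAnnals2010, Lemma 4.14 (proof)] [cite: JetchevSkinnerWan2017, §7.4.1 (arXiv:1512.06894 p. 30)] -/
theorem natCard_sha_torsionBy_baseChange_quadratic_of_odd_of_variableChange (W : WeierstrassCurve ℚ)
    [W.IsElliptic] (K : Type) [Field K] [NumberField K] (h2 : Module.finrank ℚ K = 2)
    (Wd : WeierstrassCurve ℚ) (hWd : ∃ C : VariableChange ℚ, C • W.quadraticTwist (NumberField.discr K : ℚ) = Wd)
    (W' : WeierstrassCurve K) (hW' : ∃ C : VariableChange K, C • W.baseChange K = W')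
    (p : ℕ) [Fact p.Prime] (hp2 : p ≠ 2) :
    Nat.card (W'.sha[(p : ℤ)]) = Nat.card (W.sha[(p : ℤ)]) * Nat.card (Wd.sha[(p : ℤ)]) := by
  obtain ⟨θ, c, hθ, hc⟩ := Quadratic.exists_sq_eq_algebraMap (F := ℚ) (K := K) h2
  obtain ⟨q, hq, hd⟩ := NumberField.exists_discr_eq_mul_sq h2 hθ hc
  obtain ⟨C₁, hC₁⟩ := W.exists_variableChange_quadraticTwist_mul_sq c q hq
  rw [← hd] at hC₁
  obtain ⟨Cd, hCd⟩ := hWd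
  obtain ⟨C', hC'⟩ := hW'
  subst hCd hC'
  rw [natCard_sha_torsionBy_variableChange, natCard_sha_torsionBy_variableChange, ← hC₁,
    natCard_sha_torsionBy_variableChange]
  exact natCard_sha_torsionBy_baseChange_quadratic_of_odd W K h2 hθ hc p hp2

/-- The discriminant form: `#Ш(E_K)[p] = #Ш(E)[p] · #Ш(E^{(d_K)})[p]` for odd `p` and the tree's models `W.baseChange K`,
`W.quadraticTwist d_K`. [cite: DokchitserDokchitserAnnals2010, Lemma 4.14 (proof)] -/
theorem natCard_sha_torsionBy_baseChange_quadratic_discr_of_odd (W : WeierstrassCurve ℚ) [W.IsElliptic]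
    (K : Type) [Field K] [NumberField K] (h2 : Module.finrank ℚ K = 2) (p : ℕ) [Fact p.Prime] (hp2 : p ≠ 2) :
    Nat.card ((W.baseChange K).sha[(p : ℤ)]) =
      Nat.card (W.sha[(p : ℤ)]) * Nat.card ((W.quadraticTwist (NumberField.discr K : ℚ)).sha[(p : ℤ)]) :=
  natCard_sha_torsionBy_baseChange_quadratic_of_odd_of_variableChange W K h2 _ ⟨1, one_smul _ _⟩ _
    ⟨1, one_smul _ _⟩ p hp2

end Models

end WeierstrassCurve

end
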